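import Summits.HubbardSuperconductivity.HubbardSuperconductivity.Theorems.NodalDiracTwistNodalDiracWeakCouplingIffLocusParity

/-!
# The crux from UNIQUENESS off one point + the parity flip (crux `NodalDiracWeakCoupling`, `birth` v10)

Route `HubbardSuperconductivity/NodalDiracTwist`, crux stmt-HubbardSuperconductivity-10370
(`NodalDiracWeakCoupling`), skeleton `Cruxes/NodalDiracWeakCoupling/Lines/birth.lean` v10. By
`nodalDiracWeakCoupling_iff_locusParity` (v9, landed) the crux is equivalent to LOCUS on the
fundamental triangle `0 ≤ φ₁ ≤ φ₀ ≤ π` (the `(N_L, S^z = 0)`-sector ground state of the spin-twisted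
torus `H_L(U, φ)` is degenerate iff `φ = (c, c)`) together with NC1 (opposite `x₀ ↔ x₁` parities of
the sector ground states at the twists `(0,0)` and `(π,π)`). This file removes the last EXISTENCE
statement from the physics: the degeneracy AT `(c, c)` is itself forced by the parity flip —
if the ground state were also unique at `(c,c)` it would be unique along the whole diagonal
`[0, π]`, where the swap sign is then constant (`swapSign_const_on_diagonal_segment`), contradicting
NC1 (`degenerate_of_uniq_of_parity`). Hence the crux is EQUIVALENT to

* UNIQ: the sector ground state of `H_L(U, φ)` is unique up to scalars at every twist of the closed
  triangle other than `(c, c)`, and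
* NC1,

(`nodalDiracWeakCoupling_iff_uniqParity`); the sufficiency `nodalDiracWeakCoupling_of_uniqParity`
is the composition of skeleton v10, whose only stub is the physics statement `stub_uniqParity`.

## References

H. C. Longuet-Higgins, Proc. R. Soc. A 344 (1975) 147; Y. Hatsugai, J. Phys. Soc. Jpn. 75 (2006)
123601; T. Kato, *Perturbation Theory for Linear Operators* (1966), II §5.1. No new definitions,
no named facts.
-/

-- the mandated namespace repeats `HubbardSuperconductivity` (single-problem summit, D-0017)
set_option linter.dupNamespace false

noncomputable section

namespace Summit.HubbardSuperconductivity.HubbardSuperconductivity.Theorems.NodalDiracTwist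

open Literature.MathematicalPhysics.QuantumLattice Literature.Probability.LatticeModels Matrix
open Summit.HubbardSuperconductivity.HubbardSuperconductivity.Theses.NodalDiracTwist
open Summit.HubbardSuperconductivity.HubbardSuperconductivity.Theorems.NodalDiracTwist.BridgeNodalToDWave
open scoped BigOperators ComplexOrder Matrix

/-- **The parity flip forces a degeneracy on the diagonal.** If the `(N, S^z = 0)`-sector ground
state of `H_L(U, (t,t))` is unique up to scalars for every `t ∈ [0, π]` other than `c`, and sector
ground states at `(0,0)` and `(π,π)` are swap eigenvectors with opposite signs `±1`, then at
`(c, c)` there is an orthogonal pair of sector ground states (else the swap sign would be constant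
on `[0, π]`, `swapSign_const_on_diagonal_segment`). Longuet-Higgins (1975); Hatsugai (2006).
[folklore] -/
theorem degenerate_of_uniq_of_parity (L : ℕ) [NeZero L] (U : ℝ) (N : ℕ) (c : ℝ)
    (huniq : ∀ t : ℝ, 0 ≤ t → t ≤ Real.pi → t ≠ c → ∀ χ₁ χ₂ : Fock (Orb (FermionTorus 2 L)),
      IsGroundStateInSector (spinTwistedHubbardTorus L U (fun _ : Fin 2 => t)) N 0 χ₁ →
      IsGroundStateInSector (spinTwistedHubbardTorus L U (fun _ : Fin 2 => t)) N 0 χ₂ →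
      ∃ z : ℂ, χ₂ = z • χ₁)
    (hNC1 : ∃ χ₀ χπ : Fock (Orb (FermionTorus 2 L)),
      IsGroundStateInSector (spinTwistedHubbardTorus L U (fun _ : Fin 2 => (0 : ℝ))) N 0 χ₀ ∧
      IsGroundStateInSector (spinTwistedHubbardTorus L U (fun _ : Fin 2 => Real.pi)) N 0 χπ ∧
      (((@fockD4 L _ (DihedralGroup.sr 3)).val *ᵥ χ₀ = χ₀ ∧
          (@fockD4 L _ (DihedralGroup.sr 3)).val *ᵥ χπ = -χπ) ∨
        ((@fockD4 L _ (DihedralGroup.sr 3)).val *ᵥ χ₀ = -χ₀ ∧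
          (@fockD4 L _ (DihedralGroup.sr 3)).val *ᵥ χπ = χπ))) :
    ∃ ψ₁ ψ₂ : Fock (Orb (FermionTorus 2 L)),
      IsGroundStateInSector (spinTwistedHubbardTorus L U (fun _ : Fin 2 => c)) N 0 ψ₁ ∧
      IsGroundStateInSector (spinTwistedHubbardTorus L U (fun _ : Fin 2 => c)) N 0 ψ₂ ∧
      star ψ₁ ⬝ᵥ ψ₂ = 0 := by
  by_contra hno
  -- then the ground state is unique on the whole diagonal `[0, π]`
  have hall : ∀ t ∈ Set.Icc (0 : ℝ) Real.pi, ∀ χ₁ χ₂ : Fock (Orb (FermionTorus 2 L)),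
      IsGroundStateInSector (spinTwistedHubbardTorus L U (fun _ : Fin 2 => t)) N 0 χ₁ →
      IsGroundStateInSector (spinTwistedHubbardTorus L U (fun _ : Fin 2 => t)) N 0 χ₂ →
      ∃ z : ℂ, χ₂ = z • χ₁ := by
    intro t ht χ₁ χ₂ h₁ h₂
    by_cases htc : t = c
    · subst htc
      exact unique_of_no_orthogonal_pair hno χ₁ χ₂ h₁ h₂
    · exact huniq t ht.1 ht.2 htc χ₁ χ₂ h₁ h₂
  obtain ⟨s, hs⟩ := swapSign_const_on_diagonal_segment L U N 0 Real.pi hall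
  obtain ⟨χ₀, χπ, hχ₀, hχπ, hflip⟩ := hNC1
  have h0 := hs 0 ⟨le_rfl, Real.pi_pos.le⟩ χ₀ hχ₀
  have hπ := hs Real.pi ⟨Real.pi_pos.le, le_rfl⟩ χπ hχπ
  have hsolve : ∀ (χ : Fock (Orb (FermionTorus 2 L))) (e : ℂ), χ ≠ 0 → s • χ = e • χ → s = e := by
    intro χ e hχ h
    have h' : (s - e) • χ = 0 := by rw [sub_smul, h, sub_self]
    exact sub_eq_zero.1 ((smul_eq_zero.1 h').resolve_right hχ)
  rcases hflip with ⟨h0', hπ'⟩ | ⟨h0', hπ'⟩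
  · have e0 : s = 1 := hsolve χ₀ 1 hχ₀.2.1 (by rw [← h0, h0', one_smul])
    have eπ : s = -1 := hsolve χπ (-1) hχπ.2.1 (by rw [← hπ, hπ', neg_one_smul])
    rw [e0] at eπ
    norm_num at eπ
  · have e0 : s = -1 := hsolve χ₀ (-1) hχ₀.2.1 (by rw [← h0, h0', neg_one_smul])
    have eπ : s = 1 := hsolve χπ 1 hχπ.2.1 (by rw [← hπ, hπ', one_smul])
    rw [e0] at eπ
    norm_num at eπ

/-- **LOCUS on the triangle from uniqueness off `(c, c)` + NC1.** [folklore] -/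
theorem locusTriangle_of_uniq_of_parity (L : ℕ) [NeZero L] (U : ℝ) (N : ℕ) (c : ℝ)
    (huniq : ∀ φ : Fin 2 → ℝ, 0 ≤ φ 1 → φ 1 ≤ φ 0 → φ 0 ≤ Real.pi → ¬ (φ 0 = c ∧ φ 1 = c) →
      ∀ χ₁ χ₂ : Fock (Orb (FermionTorus 2 L)),
        IsGroundStateInSector (spinTwistedHubbardTorus L U φ) N 0 χ₁ →
        IsGroundStateInSector (spinTwistedHubbardTorus L U φ) N 0 χ₂ → ∃ z : ℂ, χ₂ = z • χ₁)
    (hNC1 : ∃ χ₀ χπ : Fock (Orb (FermionTorus 2 L)),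
      IsGroundStateInSector (spinTwistedHubbardTorus L U (fun _ : Fin 2 => (0 : ℝ))) N 0 χ₀ ∧
      IsGroundStateInSector (spinTwistedHubbardTorus L U (fun _ : Fin 2 => Real.pi)) N 0 χπ ∧
      (((@fockD4 L _ (DihedralGroup.sr 3)).val *ᵥ χ₀ = χ₀ ∧
          (@fockD4 L _ (DihedralGroup.sr 3)).val *ᵥ χπ = -χπ) ∨
        ((@fockD4 L _ (DihedralGroup.sr 3)).val *ᵥ χ₀ = -χ₀ ∧
          (@fockD4 L _ (DihedralGroup.sr 3)).val *ᵥ χπ = χπ))) :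
    ∀ φ : Fin 2 → ℝ, 0 ≤ φ 1 → φ 1 ≤ φ 0 → φ 0 ≤ Real.pi →
      ((∃ ψ₁ ψ₂ : Fock (Orb (FermionTorus 2 L)),
          IsGroundStateInSector (spinTwistedHubbardTorus L U φ) N 0 ψ₁ ∧
          IsGroundStateInSector (spinTwistedHubbardTorus L U φ) N 0 ψ₂ ∧
          star ψ₁ ⬝ᵥ ψ₂ = 0) ↔ (φ 0 = c ∧ φ 1 = c)) := by
  intro φ h1 h10 h0π
  constructor
  · -- an orthogonal pair of ground states contradicts uniqueness
    rintro ⟨ψ₁, ψ₂, hψ₁, hψ₂, horth⟩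
    by_contra hne
    obtain ⟨z, hz⟩ := huniq φ h1 h10 h0π hne ψ₁ ψ₂ hψ₁ hψ₂
    rw [hz, dotProduct_smul, smul_eq_mul] at horth
    rcases mul_eq_zero.1 horth with hz0 | h11
    · exact hψ₂.2.1 (by rw [hz, hz0, zero_smul])
    · exact hψ₁.2.1 (dotProduct_star_self_eq_zero.1 h11)
  · rintro ⟨hφ0, hφ1⟩
    have hφ : φ = fun _ : Fin 2 => c := by
      funext ν; fin_cases ν <;> assumption
    subst hφ
    refine degenerate_of_uniq_of_parity L U N c (fun t ht0 htπ htc => ?_) hNC1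
    exact huniq (fun _ : Fin 2 => t) ht0 le_rfl htπ (fun h => htc h.1)

/-- **The crux reduces to UNIQ + the parity flip** (composition of skeleton v10): from the physics
statement `stub_uniqParity` — `(U, δ, κ, L₀, c)`, uniqueness of the `(N_L, S^z = 0)`-sector ground
state at every twist of the closed triangle `0 ≤ φ₁ ≤ φ₀ ≤ π` other than `(c, c)`, and NC1 — via
`locusTriangle_of_uniq_of_parity` and `nodalDiracWeakCoupling_of_locusParity`. [folklore] -/
theorem nodalDiracWeakCoupling_of_uniqParity :
    (∀ U₀ : ℝ, 0 < U₀ → ∃ U ∈ Set.Ioo (0 : ℝ) U₀, ∃ δ ∈ Set.Icc (1 / 10 : ℝ) (3 / 10),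
      ∃ κ : ℝ, 0 < κ ∧ κ < Real.pi ∧ Real.cos κ ≠ 0 ∧ ∀ ε : ℝ, 0 < ε → ∃ L₀ : ℕ,
        ∀ (L : ℕ) [NeZero L], Even L → L₀ ≤ L → (∀ m : ℤ, ε ≤ |L * κ - m * Real.pi|) →
          ∃ c : ℝ, 0 < c ∧ c < Real.pi ∧ |Real.cos c - Real.cos (L * κ)| ≤ ε ∧
            (∀ φ : Fin 2 → ℝ, 0 ≤ φ 1 → φ 1 ≤ φ 0 → φ 0 ≤ Real.pi → ¬ (φ 0 = c ∧ φ 1 = c) →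
              ∀ χ₁ χ₂ : Fock (Orb (FermionTorus 2 L)),
                IsGroundStateInSector (spinTwistedHubbardTorus L U φ) (2 * ⌊(1 - δ) * (L : ℝ) ^ 2 / 2⌋₊) 0 χ₁ →
                IsGroundStateInSector (spinTwistedHubbardTorus L U φ) (2 * ⌊(1 - δ) * (L : ℝ) ^ 2 / 2⌋₊) 0 χ₂ →
                ∃ z : ℂ, χ₂ = z • χ₁) ∧
            (∃ χ₀ χπ : Fock (Orb (FermionTorus 2 L)),
                IsGroundStateInSector (spinTwistedHubbardTorus L U (fun _ : Fin 2 => (0 : ℝ))) (2 * ⌊(1 - δ) * (L : ℝ) ^ 2 / 2⌋₊) 0 χ₀ ∧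
                IsGroundStateInSector (spinTwistedHubbardTorus L U (fun _ : Fin 2 => Real.pi)) (2 * ⌊(1 - δ) * (L : ℝ) ^ 2 / 2⌋₊) 0 χπ ∧
                (((@fockD4 L _ (DihedralGroup.sr 3)).val *ᵥ χ₀ = χ₀ ∧
                    (@fockD4 L _ (DihedralGroup.sr 3)).val *ᵥ χπ = -χπ) ∨
                  ((@fockD4 L _ (DihedralGroup.sr 3)).val *ᵥ χ₀ = -χ₀ ∧
                    (@fockD4 L _ (DihedralGroup.sr 3)).val *ᵥ χπ = χπ)))) →
    NodalDiracWeakCoupling := by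
  intro hUP
  refine nodalDiracWeakCoupling_of_locusParity fun U₀ hU₀ => ?_
  obtain ⟨U, hU, δ, hδ, κ, hκ0, hκπ, hcos, hε⟩ := hUP U₀ hU₀
  refine ⟨U, hU, δ, hδ, κ, hκ0, hκπ, hcos, fun ε hε0 => ?_⟩
  obtain ⟨L₀, hL⟩ := hε ε hε0
  refine ⟨L₀, fun L _ hEven hL₀ hres => ?_⟩
  obtain ⟨c, hc0, hcπ, hcc, huniq, hNC1⟩ := hL L hEven hL₀ hres
  exact ⟨c, hc0, hcπ, hcc, locusTriangle_of_uniq_of_parity L U _ c huniq hNC1, hNC1⟩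

/-- **`NodalDiracWeakCoupling` ⟺ UNIQ off `(c,c)` on the triangle + NC1** (route NodalDiracTwist,
crux stmt-HubbardSuperconductivity-10370; line `birth` v10). The forward direction restricts the
crux's LOCUS clause (`nodalDiracWeakCoupling_iff_locusParity`) and reads uniqueness off the locus by
Gram–Schmidt (`unique_of_no_orthogonal_pair`). [folklore] -/
theorem nodalDiracWeakCoupling_iff_uniqParity :
    NodalDiracWeakCoupling ↔
    (∀ U₀ : ℝ, 0 < U₀ → ∃ U ∈ Set.Ioo (0 : ℝ) U₀, ∃ δ ∈ Set.Icc (1 / 10 : ℝ) (3 / 10),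
      ∃ κ : ℝ, 0 < κ ∧ κ < Real.pi ∧ Real.cos κ ≠ 0 ∧ ∀ ε : ℝ, 0 < ε → ∃ L₀ : ℕ,
        ∀ (L : ℕ) [NeZero L], Even L → L₀ ≤ L → (∀ m : ℤ, ε ≤ |L * κ - m * Real.pi|) →
          ∃ c : ℝ, 0 < c ∧ c < Real.pi ∧ |Real.cos c - Real.cos (L * κ)| ≤ ε ∧
            (∀ φ : Fin 2 → ℝ, 0 ≤ φ 1 → φ 1 ≤ φ 0 → φ 0 ≤ Real.pi → ¬ (φ 0 = c ∧ φ 1 = c) →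
              ∀ χ₁ χ₂ : Fock (Orb (FermionTorus 2 L)),
                IsGroundStateInSector (spinTwistedHubbardTorus L U φ) (2 * ⌊(1 - δ) * (L : ℝ) ^ 2 / 2⌋₊) 0 χ₁ →
                IsGroundStateInSector (spinTwistedHubbardTorus L U φ) (2 * ⌊(1 - δ) * (L : ℝ) ^ 2 / 2⌋₊) 0 χ₂ →
                ∃ z : ℂ, χ₂ = z • χ₁) ∧
            (∃ χ₀ χπ : Fock (Orb (FermionTorus 2 L)),
                IsGroundStateInSector (spinTwistedHubbardTorus L U (fun _ : Fin 2 => (0 : ℝ))) (2 * ⌊(1 - δ) * (L : ℝ) ^ 2 / 2⌋₊) 0 χ₀ ∧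
                IsGroundStateInSector (spinTwistedHubbardTorus L U (fun _ : Fin 2 => Real.pi)) (2 * ⌊(1 - δ) * (L : ℝ) ^ 2 / 2⌋₊) 0 χπ ∧
                (((@fockD4 L _ (DihedralGroup.sr 3)).val *ᵥ χ₀ = χ₀ ∧
                    (@fockD4 L _ (DihedralGroup.sr 3)).val *ᵥ χπ = -χπ) ∨
                  ((@fockD4 L _ (DihedralGroup.sr 3)).val *ᵥ χ₀ = -χ₀ ∧
                    (@fockD4 L _ (DihedralGroup.sr 3)).val *ᵥ χπ = χπ)))) := by
  refine ⟨fun hND => ?_, nodalDiracWeakCoupling_of_uniqParity⟩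
  intro U₀ hU₀
  obtain ⟨U, hU, δ, hδ, κ, hκ0, hκπ, hcos, hε⟩ :=
    nodalDiracWeakCoupling_iff_locusParity.1 hND U₀ hU₀
  refine ⟨U, hU, δ, hδ, κ, hκ0, hκπ, hcos, fun ε hε0 => ?_⟩
  obtain ⟨L₀, hL⟩ := hε ε hε0
  refine ⟨L₀, fun L _ hEven hL₀ hres => ?_⟩
  obtain ⟨c, hc0, hcπ, hcc, hlocus, hNC1⟩ := hL L hEven hL₀ hres
  refine ⟨c, hc0, hcπ, hcc, fun φ h1 h10 h0π hne χ₁ χ₂ hχ₁ hχ₂ => ?_, hNC1⟩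
  exact unique_of_no_orthogonal_pair (fun hex => hne ((hlocus φ h1 h10 h0π).1 hex)) χ₁ χ₂ hχ₁ hχ₂

end Summit.HubbardSuperconductivity.HubbardSuperconductivity.Theorems.NodalDiracTwist

end
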